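import Literature.MathematicalPhysics.QuantumLattice.HubbardNNNHoppingEnergyDensityConcave
import Literature.MathematicalPhysics.QuantumLattice.HubbardDoubleOccupancyBounds
import Literature.MathematicalPhysics.QuantumLattice.HubbardFreeKineticLowerBound
import HarnessLib

/-!
# Monotonicity in `U` of the `t–t'` Hubbard ground-state energy density

Family `hubbard` (topic `MathematicalPhysics/QuantumLattice`). The `t–t'` Hubbard Hamiltonian
`H(t, t', U) = -t Σ_{⟨xy⟩σ} c†c - t' Σ_{⟨⟨xy⟩⟩σ} c†c + U Σ n↑n↓` (tree `hubbardRectTorusTT' a b t t' U`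
= `hamiltonian (n.n. graph) t U + hamiltonian (diagonal graph) t' 0`) depends on `U` only through the
positive operator `D = Σ_x n_{x↑} n_{x↓} ⪰ 0`: `H(t, t', U') = H(t, t', U) + (U' - U)·D`
(`DoubleOccupancy.re_expect_hamiltonian_eq`, `FreeKinetic.re_rayleigh_interaction_nonneg`). Hence,
by the variational characterisation of the sector ground-state energy
(`LiebThm1.groundEnergy_le_re_expect`), every sector ground-state energy is NON-DECREASING in `U`:

* `groundEnergy_hubbardRectTorusTT'_mono_U` — `U' ≤ U ⇒ E_N(t, t', U') ≤ E_N(t, t', U)` on every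
  rectangular torus `ℤ/aℤ × ℤ/bℤ`, every sector `N` (the `t' ≠ 0` twin of the tree's
  `Summit.HubbardSuperconductivity.ManyBodyBootstrap.Bounds.Adv1.groundEnergyAt_mono_U`);
* `energyDensityTT'_mono_U` — passing to the thermodynamic limit along the square tori
  (`tendsto_energyDensityTT'`, Ruelle (1969) §3.3): `0 ≤ U' ≤ U ⇒ e(t, t', U', n) ≤ e(t, t', U, n)`
  for `0 ≤ n < 2` (the `t' ≠ 0` twin of `energyDensity2D_mono_U`);
* `energyDensityTT'_anchor_le` — the corollary used by the certified-bound tables: a certified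
  LOWER bound `l ≤ e(t, t', U₀, n)` at some `0 ≤ U₀` (e.g. the free-fermion anchor `U₀ = 0`) is a
  lower bound at every `U ≥ U₀`.

Everything is proved; no definitions; no numerical input.

## References

* D. Ruelle, *Statistical Mechanics: Rigorous Results* (1969), §3.3 (thermodynamic limit of the
  ground-state energy density). [cite: Ruelle1969, §3.3]
* T. Koma, H. Tasaki, J. Stat. Phys. 76 (1994) 745, §1 (dependence of the ground-state energy on a
  coupling constant multiplying a term of the Hamiltonian). [cite: KomaTasaki1994, §1]
* J. P. F. LeBlanc et al., Phys. Rev. X 5 (2015) 041041, eq. (1) (the `t–t'–U` family).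
  [cite: LeBlancEtAl2015, eq. (1)]
-/

noncomputable section

open Matrix Finset Filter Topology Set

namespace Literature.MathematicalPhysics.QuantumLattice

namespace ThermodynamicLimit

/-! ### Finite volume -/

/-- **Monotonicity of the sector ground-state energies in the repulsion** (finite volume): for
every rectangular torus `ℤ/aℤ × ℤ/bℤ`, every `t, t'`, every particle number `N`,
`U' ≤ U ⇒ E_N(t, t', U') ≤ E_N(t, t', U)` — `H(t,t',U') = H(t,t',U) + (U' - U)·D` with
`D = Σ n↑n↓ ⪰ 0` and the variational characterisation of `groundEnergy` (empty sector: both sides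
are the junk value `0`). [cite: KomaTasaki1994, §1] -/
theorem groundEnergy_hubbardRectTorusTT'_mono_U (a b N : ℕ) (t t' : ℝ) {U U' : ℝ} (h : U' ≤ U) :
    groundEnergy (hubbardRectTorusTT' a b t t' U') N ≤
      groundEnergy (hubbardRectTorusTT' a b t t' U) N := by
  by_cases hne : ∃ ψ : Fock (Orb (Fin a ×ₗ Fin b)), IsNParticle N ψ ∧ star ψ ⬝ᵥ ψ = 1
  · obtain ⟨ψ₀, hN₀, h₀⟩ := hne
    have hS : groundEnergy (hubbardRectTorusTT' a b t t' U) N =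
        sInf {E : ℝ | ∃ ψ : Fock (Orb (Fin a ×ₗ Fin b)), IsNParticle N ψ ∧ star ψ ⬝ᵥ ψ = 1 ∧
          E = (expect (hubbardRectTorusTT' a b t t' U) ψ).re} := rfl
    rw [hS]
    refine le_csInf ⟨_, ψ₀, hN₀, h₀, rfl⟩ ?_
    rintro E ⟨ψ, hN, h1, rfl⟩
    have hv : groundEnergy (hubbardRectTorusTT' a b t t' U') N ≤
        (expect (hubbardRectTorusTT' a b t t' U') ψ).re :=
      LiebThm1.groundEnergy_le_re_expect (hubbardRectTorusTT' a b t t' U') hN h1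
    have hadd : ∀ A B : Matrix (Finset (Orb (Fin a ×ₗ Fin b))) (Finset (Orb (Fin a ×ₗ Fin b))) ℂ,
        expect (A + B) ψ = expect A ψ + expect B ψ := fun A B => by
      simp [expect, add_mulVec, dotProduct_add]
    have hU' : (expect (hubbardRectTorusTT' a b t t' U') ψ).re =
        (expect (hubbardRectTorusTT' a b t t' U) ψ).re +
          (U' - U) * (expect (∑ x : Fin a ×ₗ Fin b, numberOp x 0 * numberOp x 1) ψ).re := by
      simp only [hubbardRectTorusTT', hadd, Complex.add_re]
      rw [DoubleOccupancy.re_expect_hamiltonian_eq (fermionRectTorusGraph a b) t U U' ψ]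
      ring
    have hD : 0 ≤ (expect (∑ x : Fin a ×ₗ Fin b, numberOp x 0 * numberOp x 1) ψ).re :=
      FreeKinetic.re_rayleigh_interaction_nonneg ψ
    have hle : (U' - U) * (expect (∑ x : Fin a ×ₗ Fin b, numberOp x 0 * numberOp x 1) ψ).re ≤ 0 :=
      mul_nonpos_of_nonpos_of_nonneg (sub_nonpos.2 h) hD
    rw [hU'] at hv
    linarith
  · have h0 : ∀ V : ℝ, groundEnergy (hubbardRectTorusTT' a b t t' V) N = 0 := by
      intro V
      have hS : {E : ℝ | ∃ ψ : Fock (Orb (Fin a ×ₗ Fin b)), IsNParticle N ψ ∧ star ψ ⬝ᵥ ψ = 1 ∧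
          E = (expect (hubbardRectTorusTT' a b t t' V) ψ).re} = ∅ :=
        Set.eq_empty_iff_forall_notMem.2 (by
          rintro E ⟨ψ, hN, h1, -⟩
          exact hne ⟨ψ, hN, h1⟩)
      show sInf _ = 0
      rw [hS, Real.sInf_empty]
    simp [h0]

/-! ### Thermodynamic limit -/

/-- **Monotonicity in `U` of the `t–t'` thermodynamic-limit energy density**:
`0 ≤ U' ≤ U ⇒ e(t, t', U', n) ≤ e(t, t', U, n)` for `0 ≤ n < 2`, every `t, t'` — the pointwise limit
(`tendsto_energyDensityTT'`) of `groundEnergy_hubbardRectTorusTT'_mono_U` on the square tori.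
At `t' = 0` this is the tree's `energyDensity2D_mono_U` (`energyDensityTT'_zero`).
[cite: Ruelle1969, §3.3] -/
theorem energyDensityTT'_mono_U (t t' : ℝ) {n : ℝ} (hn0 : 0 ≤ n) (hn2 : n < 2) {U U' : ℝ}
    (hU' : 0 ≤ U') (h : U' ≤ U) :
    energyDensityTT' t t' U' n ≤ energyDensityTT' t t' U n := by
  have hU : 0 ≤ U := hU'.trans h
  refine le_of_tendsto_of_tendsto' (tendsto_energyDensityTT' t t' hU' hn0 hn2)
    (tendsto_energyDensityTT' t t' hU hn0 hn2) fun L => ?_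
  exact div_le_div_of_nonneg_right
    (groundEnergy_hubbardRectTorusTT'_mono_U L L (rectN n L) t t' h) (sq_nonneg _)

/-- **Anchor transport in `U`** (the corollary the certified-bound tables use): a lower bound
`l ≤ e(t, t', U₀, n)` certified at some `0 ≤ U₀` — e.g. the free-fermion value at `U₀ = 0` — is a
lower bound on `e(t, t', U, n)` at every `U ≥ U₀` (`0 ≤ n < 2`). [cite: Ruelle1969, §3.3] -/
theorem energyDensityTT'_anchor_le (t t' : ℝ) {n : ℝ} (hn0 : 0 ≤ n) (hn2 : n < 2) {U₀ U l : ℝ}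
    (hU₀ : 0 ≤ U₀) (h : U₀ ≤ U) (hl : l ≤ energyDensityTT' t t' U₀ n) :
    l ≤ energyDensityTT' t t' U n :=
  hl.trans (energyDensityTT'_mono_U t t' hn0 hn2 hU₀ h)

end ThermodynamicLimit

end Literature.MathematicalPhysics.QuantumLattice

end
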